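import Summits.ResolutionOfSingularities.ResolutionOfSingularities.Theorems.HomologicalConductorNoZenoExcOrderStalks
import Summits.ResolutionOfSingularities.ResolutionOfSingularities.Theorems.HomologicalConductorNoZenoCarriedPrincipal
import Summits.ResolutionOfSingularities.ResolutionOfSingularities.Theorems.HomologicalConductorNoZenoSplitExcCount
import Literature.AlgebraicGeometry.Resolution.AlterationsBoundaryDivisor
import Literature.AlgebraicGeometry.Motives.CartierDivisorOfIdealSheaf
import Literature.AlgebraicGeometry.Resolution.ExceptionalCurveDegree
import HarnessLib

/-!
# Crux `NoZenoR` (stmt-ResolutionOfSingularities-19943), slot `stub_L1wCoreF3`, (B1) split core: the elements of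
# `𝔞` are global sections of `𝒪_X(−Z)`, `Z` the Cartier divisor of `𝔞·𝒪_X`, and at every point one of them
# generates

Route `ResolutionOfSingularities/HomologicalConductor`.  OURS (cell res-hironaka, crux chain W4.4, lead seat
res-L0-w44-lead-1 g8, memo `B1-CENSUS-g8.md`); nothing here is a statement of the manuscript under review (Hironaka
2017); AI-written, weaker than expert review.

Companion of `…NoZenoBaseIdealCartier` (the base ideal sheaf `𝔞𝒪_X = ofIdealTop (𝔞·Γ(X, 𝒪_X))` is an effective
Cartier divisor `Z := CartierDivisor.ofIsEffectiveCartier (𝔞𝒪_X) hJ`).  This file supplies the `hgen` input of the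
packaged UP-1′ theorem `ExcCount.exists_excCurveDegree_neg_of_forall_isSection_neg` (p554806): for `π : X → Spec T`,
`X` integral,

* `secFn_algebraMapΓ_eq_baseToFunctionField` — the rational function of the global section `t ∈ T` is
  `baseToFunctionField π t`;
* `isSection_neg_baseIdealDivisor` — **every `c ∈ 𝔞` is a global section of `𝒪_X(−Z)`** (`(-Z).IsSection (c)`):
  on an affine open inside a Cartier chart the sections of `𝒪_X(−Z)` are exactly `𝔞𝒪_X` (tree
  `CartierDivisor.sectionIdeal_ofIsEffectiveCartier_eq`);
* `exists_mem_nonvanishing_neg_baseIdealDivisor` — **at every point `x` some `c ∈ 𝔞` generates `𝒪_X(−Z)_x`**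
  (`x ∈ (-Z).nonvanishing (c)`): the stalk `(𝔞𝒪_X)_x = 𝔞·𝒪_(X,x)` is principal, so one of the images of `𝔞` generates it
  (Nakayama in the local ring `𝒪_(X,x)`, tree `exists_mem_span_singleton_eq_of_span_eq`);
* `forall_exists_isSection_nonvanishing_neg_baseIdealDivisor` — the two combined in the `hgen` shape.

References: U. Görtz, T. Wedhorn, *Algebraic Geometry I* (2020), Remark 11.27 / (11.12) [`GortzWedhorn2020`]; The Stacks
Project, Tag 01WS [`StacksProject`].
-/

noncomputable section

-- single-problem summit: the doubled namespace component `ResolutionOfSingularities` is forced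
set_option linter.dupNamespace false

namespace Summit.ResolutionOfSingularities.ResolutionOfSingularities.Theorems.NoZeno.ExcCount

open CategoryTheory AlgebraicGeometry TopologicalSpace IsLocalRing Opposite
open Literature.AlgebraicGeometry Literature.AlgebraicGeometry.Resolution Literature.AlgebraicGeometry.Motives
open Literature.AlgebraicGeometry.Motives.RatFn
open Summit.ResolutionOfSingularities.ResolutionOfSingularities.Theorems.NoZeno.SandwichCluster
  (toFunctionField_germ_appTop)
open Summit.ResolutionOfSingularities.ResolutionOfSingularities.Theorems.NoZeno.SandwichCluster.LemmaL
  (stalkIdeal_ofIdealTop_map)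

variable {T : Type} [CommRing T] {X : Scheme.{0}} [IsIntegral X] (π : X ⟶ Spec (.of T)) {𝔞 : Ideal T}
  (hJ : IsEffectiveCartier (Scheme.IdealSheafData.ofIdealTop (𝔞.map (Morphisms.algebraMapΓ π))))

/-- The rational function of the global section of `t ∈ T` is `baseToFunctionField π t`. [folklore] -/
theorem secFn_algebraMapΓ_eq_baseToFunctionField {y : X} (hy : y ∈ (⊤ : X.Opens)) (t : T) :
    secFn hy (Morphisms.algebraMapΓ π t) = baseToFunctionField π t := by
  rw [← toFunctionField_germ_eq_secFn hy hy]
  exact toFunctionField_germ_appTop π y t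

include hJ in
/-- **Every element of `𝔞` is a global section of `𝒪_X(−Z)`**, `Z` the Cartier divisor of `𝔞𝒪_X`: on each chart
`U_i` the local equation `f_i` generates `𝔞𝒪_X`, so `c / f_i` is regular there.
[cite: GortzWedhorn2020, Remark 11.27 and (11.12) (pp. 378–379)] -/
theorem isSection_neg_baseIdealDivisor {c : T} (hc : c ∈ 𝔞) :
    (-CartierDivisor.ofIsEffectiveCartier _ hJ).IsSection (baseToFunctionField π c) := by
  intro i y hyi
  -- an affine neighbourhood `W` of `y` inside the chart `U_i`
  obtain ⟨W, hWa, hyW, hWle⟩ := exists_isAffineOpen_mem_and_subset (X := X) (x := y)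
    (U := (CartierDivisor.ofIsEffectiveCartier _ hJ).U i) hyi
  -- the restriction of the global section `c` to `W` lies in `𝔞𝒪_X(W) = sectionIdeal W`
  set cW : Γ(X, W) := X.presheaf.map (homOfLE (le_top : W ≤ ⊤)).op (Morphisms.algebraMapΓ π c) with hcW
  have hmemJ : cW ∈ (Scheme.IdealSheafData.ofIdealTop (𝔞.map (Morphisms.algebraMapΓ π))).ideal ⟨W, hWa⟩ := by
    rw [Scheme.IdealSheafData.ofIdealTop_ideal]
    exact Ideal.mem_map_of_mem _ (Ideal.mem_map_of_mem _ hc)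
  have hmem : cW ∈ (CartierDivisor.ofIsEffectiveCartier _ hJ).sectionIdeal ⟨W, hWa⟩ := by
    rw [CartierDivisor.sectionIdeal_ofIsEffectiveCartier_eq _ hJ ⟨W, hWa⟩ hyW hWle]
    exact hmemJ
  have hreg := (CartierDivisor.mem_sectionIdeal_iff.mp hmem) i y hyW hyi
  have hcfn : secFn hyW cW = baseToFunctionField π c := by
    rw [hcW, secFn_map (le_top : W ≤ ⊤) hyW]
    exact secFn_algebraMapΓ_eq_baseToFunctionField π trivial c
  rw [hcfn] at hreg
  rw [CartierDivisor.neg_f, ← div_eq_inv_mul]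
  exact hreg

include hJ in
/-- **At every point some element of `𝔞` generates `𝒪_X(−Z)`** (Nakayama in `𝒪_(X,x)`: the principal stalk
`𝔞·𝒪_(X,x)` is generated by one of the images of `𝔞`). [cite: StacksProject, Tag 01WS] -/
theorem exists_mem_nonvanishing_neg_baseIdealDivisor (x : X) :
    ∃ c ∈ 𝔞, x ∈ (-CartierDivisor.ofIsEffectiveCartier _ hJ).nonvanishing (baseToFunctionField π c) := by
  have hxU : x ∈ (CartierDivisor.cartierChart _ hJ x : X.Opens) := CartierDivisor.mem_cartierChart _ hJ x
  -- the stalk `(𝔞𝒪_X)_x` is generated by the germ of the chart generator `g`, and by the images of `𝔞`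
  have hgerm0 : (X.presheaf.germ _ x hxU).hom (CartierDivisor.cartierGen _ hJ x) ≠ 0 := fun h0 =>
    CartierDivisor.cartierGen_ne_zero _ hJ x
      (germ_injective_of_isIntegral (X := X) x hxU (h0.trans (map_zero _).symm))
  have hspan : Ideal.span ((((X.presheaf.germ ⊤ x trivial).hom.comp (Morphisms.algebraMapΓ π)) : T → _) '' 𝔞) =
      Ideal.span {(X.presheaf.germ _ x hxU).hom (CartierDivisor.cartierGen _ hJ x)} := by
    have h1 := stalkIdeal_ofIdealTop_map π 𝔞 x
    have h2 : stalkIdeal (Scheme.IdealSheafData.ofIdealTop (𝔞.map (Morphisms.algebraMapΓ π))) x =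
        Ideal.span {(X.presheaf.germ _ x hxU).hom (CartierDivisor.cartierGen _ hJ x)} := by
      rw [stalkIdeal_eq_map_germ _ (CartierDivisor.cartierChart _ hJ x) hxU,
        CartierDivisor.ideal_cartierChart, Ideal.map_span, Set.image_singleton]
    rw [← h2, h1, Ideal.map]
  obtain ⟨_, ⟨c, hc, rfl⟩, hgen⟩ := exists_mem_span_singleton_eq_of_span_eq hgerm0 hspan
  refine ⟨c, hc, ?_⟩
  -- `c = g · u` in `𝒪_(X,x)` for a unit `u`
  obtain ⟨u, hu⟩ := Ideal.span_singleton_eq_span_singleton.mp hgen.symm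
  -- read in `K(X)`
  have hcK : baseToFunctionField π c =
      toFunctionField x (((X.presheaf.germ ⊤ x trivial).hom.comp (Morphisms.algebraMapΓ π)) c) :=
    (toFunctionField_germ_appTop π x c).symm
  have hgK : (CartierDivisor.ofIsEffectiveCartier _ hJ).f x =
      toFunctionField x ((X.presheaf.germ _ x hxU).hom (CartierDivisor.cartierGen _ hJ x)) := by
    rw [CartierDivisor.ofIsEffectiveCartier_f, ← toFunctionField_germ_eq_secFn hxU hxU]
  have hg0 : toFunctionField x ((X.presheaf.germ _ x hxU).hom (CartierDivisor.cartierGen _ hJ x)) ≠ 0 := by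
    rw [← hgK]; exact (CartierDivisor.ofIsEffectiveCartier _ hJ).f_ne_zero x
  have hxU' : x ∈ (-CartierDivisor.ofIsEffectiveCartier _ hJ).U x := hxU
  rw [CartierDivisor.mem_nonvanishing_iff hxU', CartierDivisor.neg_f, hcK, hgK, ← hu, map_mul, ← mul_assoc,
    inv_mul_cancel₀ hg0, one_mul]
  exact ⟨u, rfl⟩

include hJ in
/-- **The `hgen` input of UP-1′ for the divisor of a base ideal**: at every point (in particular at every integral
exceptional curve) `𝒪_X(−Z)` has a global section — an element of `𝔞` — generating it there. [this work] -/
theorem forall_exists_isSection_nonvanishing_neg_baseIdealDivisor (x : X) :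
    ∃ s : X.functionField, (-CartierDivisor.ofIsEffectiveCartier _ hJ).IsSection s ∧
      x ∈ (-CartierDivisor.ofIsEffectiveCartier _ hJ).nonvanishing s := by
  obtain ⟨c, hc, hx⟩ := exists_mem_nonvanishing_neg_baseIdealDivisor π hJ x
  exact ⟨_, isSection_neg_baseIdealDivisor π hJ hc, hx⟩

end Summit.ResolutionOfSingularities.ResolutionOfSingularities.Theorems.NoZeno.ExcCount

end
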